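import Literature.AnabelianGeometry.AbsoluteAnabelian.AbsTopIII.KummerSeparationLaws
import HarnessLib

/-!
# [AbsTopIII] Thm. 1.9 (d)(e): along a transition of a tagged system, a cusp lying over a CUSP is a
# genuine cusp — "case β" of the degree-transport law is empty at law-abiding models (proof-only)

Mochizuki, *Topics in Absolute Anabelian Geometry III*, §1, Thm. 1.9 (d)(e) pp. 37–38 ("`V` ranges over the
open subschemes obtained by removing finite collections of NF-points from `Z ×_{k_Z} k′`"), Prop. 1.6 (ii)
p. 34 (points are recovered from — hence separated by — their decomposition data over Kummer-faithful
fields); lit key `paper:url-5493eb38cbb7`.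

Proof-only companion (abc-iut-L4-t1, owner of the law tower I–IV) of abc-iut-w5-d213's layer V
`KummerSeparationLaws.lean` (`SeparatedKummerModel`).  The degree-transport law (D-transport) of layer V
tests "the cusp `c_j` of `V_j` lies over the cusp `c_i` of `V_i`" along a factored transition
`t = (V_j ⊆ W) ≫ (W → V_i)` by DECOMPOSITION-GROUP containment `t(D_{c_j}) ⊆ g D_{c_i} g⁻¹`.  A priori a
cusp `c_j` of `V_j` is of one of two kinds: (α) a cusp of `W` (unramified over a cusp of `V_i`), or (β) a
closed point `y` of `W` removed in `V_j` (`cuspPt hVW c_j = some y`), whose decomposition group `t` maps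
onto a finite-index subgroup of a POINT's decomposition group of `V_i`.  THIS FILE proves, from the laws
of layers I–V alone, that kind (β) is INCOMPATIBLE with the containment whenever the compactification `Z_i`
of `V_i` is a proper scheme-like curve of genus `≥ 2` over a Kummer-faithful field:

* `SeparatedKummerModel.cuspPt_eq_none_of_dcusp_map_le_conj` — under these hypotheses,
  `t(D_{c_j}) ⊆ g D_{c_i} g⁻¹` forces `cuspPt hVW c_j = none` (the cusp is a genuine cusp of `W`);
* `SeparatedKummerModel.exists_cuspRes_of_dcusp_map_le_conj` — hence `c_j` is the cusp
  `cuspRes hVW c_j _` of `W`, whose decomposition group maps (along the base-change leg) into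
  `g D_{c_i} g⁻¹`.

Route (all inputs BY NAME from the law tower): `decomp_cuspPt` (layer I: `D_{c_j} ↦` a conjugate of
`D^W_y`), `decomp_bcPt_finiteIndex` (layer V, (S-bcfin): `D^W_y ↦` finite index in a conjugate of
`D^{V_i}_{y_i}`), push-forward along `Π_{V_i} ↠ Π_{Z_i}` (`decomp_ptRes`, `decomp_cuspPt` for the proper
`Z_i`), the separation law (S-fin) `point_eq_of_finiteIndex_le_conj` on `Z_i` (⇒ the point `y_i ∈ V_i`
IS the point of `Z_i` filled by `c_i`), contradicting `cuspPt_ne_ptRes`.  This is the kernel form of the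
remark that makes the guarded reading of (D-transport) honest (abc-iut-L4-t1 owner read F-t1g4-1): over
Kummer-faithful bases the decomposition-containment test already singles out genuine, unramified cusps.
All declarations are theorems; no new facts; nothing here bears on [IUTchIII] Cor. 3.12.
-/

noncomputable section

open CategoryTheory
open scoped Classical Pointwise

namespace Literature.AnabelianGeometry.AbsoluteAnabelian.AbsTopIII

universe u

namespace SeparatedKummerModel

variable (M : SeparatedKummerModel.{u})

/-- Finite index survives taking images: if `A ≤ B` with `[B : A] < ∞` then `[f(B) : f(A)] < ∞`
(`[f(B) : f(A)]` divides `[B : A]`). [cite: MochizukiAbsTopIII2015, Thm 1.9 (e) p.38] -/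
theorem relIndex_map_ne_zero {G H : Type*} [Group G] [Group H] (f : G →* H) {A B : Subgroup G}
    (hle : A ≤ B) (h : A.relIndex B ≠ 0) : (A.map f).relIndex (B.map f) ≠ 0 := by
  have hφ : Function.Surjective (f.subgroupMap B) := f.subgroupMap_surjective B
  have hdvd : ((A.subgroupOf B).map (f.subgroupMap B)).index ∣ (A.subgroupOf B).index :=
    Subgroup.index_map_dvd _ hφ
  have heq : (A.subgroupOf B).map (f.subgroupMap B) = (A.map f).subgroupOf (B.map f) := by
    ext x
    simp only [Subgroup.mem_map, Subgroup.mem_subgroupOf]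
    constructor
    · rintro ⟨b, hbA, hbx⟩
      refine ⟨(b : G), hbA, ?_⟩
      rw [← hbx]
      rfl
    · rintro ⟨a, haA, hax⟩
      refine ⟨⟨a, hle haA⟩, haA, Subtype.ext ?_⟩
      exact hax
  intro h0
  apply h
  rw [Subgroup.relIndex] at h0 ⊢
  rw [← heq] at h0
  exact Nat.eq_zero_of_zero_dvd (h0 ▸ hdvd)

variable {M}

/-- **Kind (β) is empty**: for a factored transition `t = (V_j ⊆ W) ≫ (W → V_i)` (cofinite open followed by a
base-change leg), `V_i ⊆ Z_i` a cofinite open of a PROPER scheme-like `Z_i` of genus `≥ 2` over a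
Kummer-faithful field, a cusp `c_j` of `V_j` whose decomposition group maps into a conjugate of the
decomposition group of a cusp `c_i` of `V_i` is NOT a point of `W` removed in `V_j`: `cuspPt hVW c_j = none`.
(Otherwise `t(D_{c_j})` is a finite-index subgroup of a conjugate of the decomposition group of the image
point `y_i ∈ V_i`; pushed into `Π_{Z_i}` it lies both in a conjugate of `D_{y_i}` with finite index and in a
conjugate of the decomposition group of the point filled by `c_i`, so (S-fin) identifies the two points of
`Z_i` — but one lies in `V_i` and the other does not.) [cite: MochizukiAbsTopIII2015, Thm 1.9 (e) p.38] -/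
theorem cuspPt_eq_none_of_dcusp_map_le_conj {Vj W Vi Zi : M.Curve} (hVW : M.IsCofiniteOpen Vj W)
    (hWV : M.IsBaseChangeOf W Vi) (hi : M.IsCofiniteOpen Vi Zi) (hZp : M.IsProper Zi)
    (hZs : M.IsScheme Zi) (hg2 : 2 ≤ M.genus Zi) (hK : IsKummerFaithful (M.base Zi))
    (ci : (M.cusps Vi).Cusp) (cj : (M.cusps Vj).Cusp) (g : (M.ext Vi).arith)
    (hle : ((M.cusps Vj).Dcusp cj).map (M.res hVW ≫ M.bc hWV).arith.toMonoidHom ≤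
      MulAut.conj g • (M.cusps Vi).Dcusp ci) :
    M.cuspPt hVW cj = none := by
  -- conjugation commutes with homomorphisms on subgroups (the tree's `GalSect.map_conj_smul`, restated
  -- locally to keep the étale-theta tower out of the imports of this interface file)
  have map_conj_smul_eq : ∀ {G H : Type u} [Group G] [Group H] (f : G →* H) (g : G) (K : Subgroup G),
      (MulAut.conj g • K).map f = MulAut.conj (f g) • K.map f := by
    intro G H _ _ f g K
    ext y
    simp only [Subgroup.mem_map, Subgroup.mem_smul_pointwise_iff_exists, MulAut.smul_def,
      MulAut.conj_apply]
    constructor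
    · rintro ⟨_, ⟨k, hk, rfl⟩, rfl⟩
      exact ⟨f k, ⟨k, hk, rfl⟩, by rw [map_mul, map_mul, map_inv]⟩
    · rintro ⟨_, ⟨k, hk, rfl⟩, rfl⟩
      exact ⟨g * k * g⁻¹, ⟨k, hk, rfl⟩, by rw [map_mul, map_mul, map_inv]⟩
  rcases hcj : M.cuspPt hVW cj with _ | y
  · rfl
  exfalso
  -- (1) layer I: `D_{c_j} ↦ g₁ D^W_y g₁⁻¹` under `Π_{V_j} ↠ Π_W`
  obtain ⟨g₁, hg₁⟩ := M.decomp_cuspPt hVW cj y hcj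
  -- (2) layer V (S-bcfin): `D^W_y ↦` finite index inside `g₂ D^{V_i}_{y_i} g₂⁻¹`
  obtain ⟨g₂, hle₂, hidx₂⟩ := M.decomp_bcPt_finiteIndex hWV y
  set H₀ : Subgroup (M.ext Vi).arith := (M.decomp W y).map (M.bc hWV).arith.toMonoidHom with hH₀
  -- the hypothesis in terms of `H₀`
  have hle₀ : H₀ ≤ MulAut.conj (((M.bc hWV).arith g₁)⁻¹ * g) • (M.cusps Vi).Dcusp ci := by
    have hrw : ((M.cusps Vj).Dcusp cj).map (M.res hVW ≫ M.bc hWV).arith.toMonoidHom =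
        MulAut.conj ((M.bc hWV).arith g₁) • H₀ := by
      have hcomp : (M.res hVW ≫ M.bc hWV).arith.toMonoidHom =
          ((M.bc hWV).arith.toMonoidHom).comp (M.res hVW).arith.toMonoidHom := rfl
      rw [hcomp, ← Subgroup.map_map, hg₁, map_conj_smul_eq]
      rfl
    rw [hrw] at hle
    rw [map_mul, mul_smul, Subgroup.subset_pointwise_smul_iff, map_inv, inv_inv]
    exact hle
  -- (3) push everything into `Π_{Z_i}` along `r := Π_{V_i} ↠ Π_{Z_i}`
  set r : (M.ext Vi).arith →* (M.ext Zi).arith := (M.res hi).arith.toMonoidHom with hr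
  obtain ⟨g₃, hg₃⟩ := M.decomp_ptRes hi (M.bcPt hWV y)
  obtain ⟨p, hp⟩ := Option.isSome_iff_exists.1 (M.cuspPt_isSome hi hZp ci)
  obtain ⟨g₄, hg₄⟩ := M.decomp_cuspPt hi ci p hp
  -- `r(H₀)` has finite index in `r(g₂) g₃ • D^{Z_i}_{x′}`, `x′ := ptRes hi y_i`
  have hA : H₀.map r ≤ MulAut.conj (r g₂ * g₃) • M.decomp Zi (M.ptRes hi (M.bcPt hWV y)) := by
    have := Subgroup.map_mono (f := r) hle₂
    rw [map_conj_smul_eq, hg₃, ← mul_smul, ← map_mul] at this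
    exact this
  have hAidx : (H₀.map r).relIndex
      (MulAut.conj (r g₂ * g₃) • M.decomp Zi (M.ptRes hi (M.bcPt hWV y))) ≠ 0 := by
    have := relIndex_map_ne_zero r hle₂ hidx₂
    rw [map_conj_smul_eq, hg₃, ← mul_smul, ← map_mul] at this
    exact this
  -- `r(H₀)` lies in `r((bc g₁)⁻¹ g) g₄ • D^{Z_i}_p`
  have hB : H₀.map r ≤ MulAut.conj (r (((M.bc hWV).arith g₁)⁻¹ * g) * g₄) • M.decomp Zi p := by
    have := Subgroup.map_mono (f := r) hle₀
    rw [map_conj_smul_eq, hg₄, ← mul_smul, ← map_mul] at this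
    exact this
  -- (4) conjugate back into `D^{Z_i}_{x′}` itself and apply (S-fin)
  set a : (M.ext Zi).arith := r g₂ * g₃ with ha
  set b : (M.ext Zi).arith := r (((M.bc hWV).arith g₁)⁻¹ * g) * g₄ with hb
  have hA' : MulAut.conj a⁻¹ • H₀.map r ≤ M.decomp Zi (M.ptRes hi (M.bcPt hWV y)) := by
    rw [map_inv, ← Subgroup.subset_pointwise_smul_iff]
    exact hA
  have hA'idx : (MulAut.conj a⁻¹ • H₀.map r).relIndex (M.decomp Zi (M.ptRes hi (M.bcPt hWV y))) ≠ 0 := by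
    have h := hAidx
    rw [← Subgroup.relIndex_pointwise_smul (MulAut.conj a⁻¹), map_inv, inv_smul_smul] at h
    rwa [map_inv]
  have hB' : MulAut.conj a⁻¹ • H₀.map r ≤ MulAut.conj (a⁻¹ * b) • M.decomp Zi p := by
    rw [map_mul, mul_smul]
    exact Subgroup.pointwise_smul_le_pointwise_smul_iff.2 hB
  have heq : M.ptRes hi (M.bcPt hWV y) = p :=
    M.point_eq_of_finiteIndex_le_conj Zi hZs hg2 hK p (M.ptRes hi (M.bcPt hWV y))
      (MulAut.conj a⁻¹ • H₀.map r) (a⁻¹ * b) hA' hA'idx hB'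
  -- (5) but `c_i` fills `p`, which is then a point of `V_i`: contradiction
  exact M.cuspPt_ne_ptRes hi ci (M.bcPt hWV y) (hp.trans (congrArg some heq.symm))

/-- **Hence a genuine cusp**: under the same hypotheses the cusp `c_j` of `V_j` is the cusp
`cuspRes hVW c_j _` of `W` (layer IV), and the decomposition group of that cusp of `W` maps along the
base-change leg `W → V_i` into `g D_{c_i} g⁻¹`. [cite: MochizukiAbsTopIII2015, Thm 1.9 (e) p.38] -/
theorem exists_cuspRes_of_dcusp_map_le_conj {Vj W Vi Zi : M.Curve} (hVW : M.IsCofiniteOpen Vj W)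
    (hWV : M.IsBaseChangeOf W Vi) (hi : M.IsCofiniteOpen Vi Zi) (hZp : M.IsProper Zi)
    (hZs : M.IsScheme Zi) (hg2 : 2 ≤ M.genus Zi) (hK : IsKummerFaithful (M.base Zi))
    (ci : (M.cusps Vi).Cusp) (cj : (M.cusps Vj).Cusp) (g : (M.ext Vi).arith)
    (hle : ((M.cusps Vj).Dcusp cj).map (M.res hVW ≫ M.bc hWV).arith.toMonoidHom ≤
      MulAut.conj g • (M.cusps Vi).Dcusp ci) :
    ∃ hc : M.cuspPt hVW cj = none,
      ((M.cusps W).Dcusp (M.cuspRes hVW cj hc)).map (M.bc hWV).arith.toMonoidHom ≤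
        MulAut.conj g • (M.cusps Vi).Dcusp ci := by
  have hc : M.cuspPt hVW cj = none :=
    cuspPt_eq_none_of_dcusp_map_le_conj hVW hWV hi hZp hZs hg2 hK ci cj g hle
  refine ⟨hc, ?_⟩
  have hcomp : (M.res hVW ≫ M.bc hWV).arith.toMonoidHom =
      ((M.bc hWV).arith.toMonoidHom).comp (M.res hVW).arith.toMonoidHom := rfl
  rw [hcomp, ← Subgroup.map_map, M.decomp_cuspRes hVW cj hc] at hle
  exact hle

end SeparatedKummerModel

end Literature.AnabelianGeometry.AbsoluteAnabelian.AbsTopIII
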